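import Mathlib
import Summits.ValiantsHypothesis.ValiantsHypothesis.Theorems.RigidityForcesSymmetryRankRigidMinimalReprLaplaceHybridRows

/-!
# The interleaved hybrid witness lemma, part 2: the construction (basis rows anywhere, one absorbed constraint per slot)
# (crux `RankRigidMinimalRepr`, stmt-ValiantsHypothesis-18034; frontier rung `LaplaceOptimalFive`, stmt-24813)

The strongest form of the greedy dual-witness construction found by the exhaustive certificate search of p8 g10
(evidence note NOTE-p8g10-24813 on the item; `game.py` / `game3.py`): compared with `hybrid_witness`
(`…LaplaceHybridWitness.lean`) the BASIS positions may be INTERLEAVED with the general ones, and a basis position `r` may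
DESIGNATE one constraint vector `Nv t φ` of a later slot that is already determined at position `r` (a slice vector, or a
pair vector whose other slot(s) come before `r`): the basis column is then chosen in the support of that vector among the
remaining columns (if the vector vanishes there the constraint is void on the remaining columns), and the slot of `t`
gets ONE free condition (single credit per slot).  A basis slot may itself carry one constraint if it is credited.

* part 1 (`…LaplaceHybridRows.lean`): `permanent_eq_prod_of_interleaved`, `general_row`, `basis_row`;
* `hybrid_witness2` — the construction.  COUNT: general position `j` (slot `s`, `m_s` charged terms, `cr_s ∈ {0,1}`
  credits): `m_s - cr_s + j ≤ n - 1`; basis position: `m_s ≤ cr_s`.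

By exhaustive search this certificate shape covers ALL maximal cheap profiles of `P₅` with `≥ 3` slices (123) and 228 of
the 350 with two slices (kill sides chosen per pair).  General `n`; no new definitions.  HONEST FRAMING: infrastructure
for the frontier rung `LaplaceOptimalFive` (stmt-24813), which stays OPEN; nothing here bears on `VP ≠ VNP`.
-/

set_option autoImplicit false

-- the mandated summit-side namespace repeats a component by design (single-problem summit)
set_option linter.dupNamespace false

namespace Summit.ValiantsHypothesis.ValiantsHypothesis.Theorems.RigidityForcesSymmetryRankRigidMinimalRepr

namespace LaplaceTriangular

open Finset Module

variable {n : ℕ}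

/-! ### §3 The interleaved construction -/

/-- **Interleaved hybrid witness lemma** (single credit per slot).  Positions are processed along `ord`; `isB j` marks the
basis positions.  Terms `t` are charged to slots `l t` with constraint vectors `Nv t φ` depending only on the covectors
of slots before `l t` (`hloc`).  A basis position `r` may designate a term `des r = some t` charged LATER whose vector is
already determined at position `r` (`hdes`); distinct designations credit distinct slots (`hdes1`).  COUNTS: at a general
position `j`, `#charged + j + 1 ≤ n + #credits`; at a basis position, `#charged ≤ #credits` (credits of position `j` =
designations `r < j` of terms charged at `ord j`; at most one).  Then covectors killing every charged constraint with
non-zero permanent exist. -/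
theorem hybrid_witness2 {N : ℕ} (ord : Equiv.Perm (Fin n)) (isB : Fin n → Bool)
    (l : Fin N → Fin n) (Nv : Fin N → (Fin n → Fin n → ℂ) → (Fin n → ℂ))
    (hloc : ∀ t, ∀ φ φ' : Fin n → Fin n → ℂ, (∀ s, ord.symm s < ord.symm (l t) → φ s = φ' s) → Nv t φ = Nv t φ')
    (des : Fin n → Option (Fin N))
    (hdes : ∀ r t, des r = some t → isB r = true ∧ r < ord.symm (l t) ∧
      ∀ φ φ' : Fin n → Fin n → ℂ, (∀ s, ord.symm s < r → φ s = φ' s) → Nv t φ = Nv t φ')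
    (hdes1 : ∀ r r' t t', des r = some t → des r' = some t' → l t = l t' → r = r')
    (hcountG : ∀ j : Fin n, isB j = false →
      (univ.filter (fun t => l t = ord j)).card + (j : ℕ) + 1 ≤
        n + (univ.filter (fun r : Fin n => r < j ∧ ∃ t, des r = some t ∧ l t = ord j)).card)
    (hcountB : ∀ j : Fin n, isB j = true →
      (univ.filter (fun t => l t = ord j)).card ≤
        (univ.filter (fun r : Fin n => r < j ∧ ∃ t, des r = some t ∧ l t = ord j)).card) :
    ∃ φ : Fin n → Fin n → ℂ,
      (∀ t, ∑ y, φ (l t) y * Nv t φ y = 0) ∧ (Matrix.of fun c i => φ i c).permanent ≠ 0 := by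
  classical
  -- credits: at most one per position
  have hcred_le : ∀ j : Fin n,
      (univ.filter (fun r : Fin n => r < j ∧ ∃ t, des r = some t ∧ l t = ord j)).card ≤ 1 := by
    intro j
    refine card_le_one.mpr (fun r hr r' hr' => ?_)
    simp only [mem_filter, mem_univ, true_and] at hr hr'
    obtain ⟨-, t, ht, hlt⟩ := hr
    obtain ⟨-, t', ht', hlt'⟩ := hr'
    exact hdes1 r r' t t' ht ht' (hlt.trans hlt'.symm)
  -- INVARIANT after processing the positions `< j`
  have step : ∀ j : ℕ, j ≤ n → ∃ (φ : Fin n → Fin n → ℂ) (c : Fin n → Fin n),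
      (∀ m : Fin n, (m : ℕ) < j → isB m = false →
        φ (ord m) (c m) ≠ 0 ∧ ∀ m' : Fin n, m' < m → isB m' = false → φ (ord m) (c m') = 0) ∧
      (∀ m : Fin n, (m : ℕ) < j → isB m = true →
        φ (ord m) (c m) ≠ 0 ∧ ∀ x, φ (ord m) x ≠ 0 → x = c m ∨ ∃ m' : Fin n, m' < m ∧ isB m' = true ∧ x = c m') ∧
      (∀ t, (ord.symm (l t) : ℕ) < j → ∑ y, φ (l t) y * Nv t φ y = 0) ∧
      (∀ m m' : Fin n, (m : ℕ) < j → (m' : ℕ) < j → c m = c m' → m = m') ∧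
      (∀ r : Fin n, (r : ℕ) < j → ∀ t, des r = some t → j ≤ (ord.symm (l t) : ℕ) →
        Nv t φ (c r) ≠ 0 ∨ ∀ x, (∀ m : Fin n, m ≤ r → x ≠ c m) → Nv t φ x = 0) := by
    intro j
    induction j with
    | zero =>
      intro _
      exact ⟨fun _ _ => 0, fun m => m, fun m hm => absurd hm (by omega), fun m hm => absurd hm (by omega),
        fun t ht => absurd ht (by omega), fun m m' hm => absurd hm (by omega), fun r hr => absurd hr (by omega)⟩
    | succ j ih =>
      intro hj
      obtain ⟨φ, c, hV1, hV2, hV3, hV4, hV5⟩ := ih (by omega)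
      set jf : Fin n := ⟨j, by omega⟩ with hjf
      set s : Fin n := ord jf with hs
      have hsj : ord.symm s = jf := by rw [hs, Equiv.symm_apply_apply]
      have hjs : ∀ m : Fin n, (m : ℕ) < j → ord m ≠ s := fun m hm h => by
        have := ord.injective (h.trans hs); rw [this] at hm; exact lt_irrefl _ hm
      -- pivots used so far
      let Used : Finset (Fin n) := (univ.filter (fun m : Fin n => (m : ℕ) < j)).image c
      have hUsed_mem : ∀ x, x ∈ Used ↔ ∃ m : Fin n, (m : ℕ) < j ∧ c m = x := fun x => by simp [Used]
      have hUsed : Used.card ≤ j := by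
        refine card_image_le.trans ?_
        have : (univ.filter (fun m : Fin n => (m : ℕ) < j)) = Finset.Iio jf := by
          ext m; simp [Finset.mem_Iio, Fin.lt_def, hjf]
        rw [this, Fin.card_Iio]
      -- every constraint vector charged at `s` is determined by now; designation vectors are stable
      -- CREDIT data
      have hcr_dec : ∀ r : Fin n, r < jf → ∀ t, des r = some t → l t = s →
          c r ∈ Used ∧ (Nv t φ (c r) ≠ 0 ∨ ∀ x, x ∉ Used → Nv t φ x = 0) := by
        intro r hr t ht hlt
        have hrj : (r : ℕ) < j := by rw [Fin.lt_def] at hr; exact hr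
        refine ⟨(hUsed_mem _).mpr ⟨r, hrj, rfl⟩, ?_⟩
        rcases hV5 r hrj t ht (by rw [hlt, hsj]) with h | h
        · exact Or.inl h
        · right; intro x hx
          refine h x (fun m hm e => hx ((hUsed_mem x).mpr ⟨m, ?_, e.symm⟩))
          exact lt_of_le_of_lt hm hrj
      -- the new row, with a uniform specification
      obtain ⟨ψ, cj, hcjU, hψcj, hkill, hgenP, hbasP, hprom'⟩ : ∃ (ψ : Fin n → ℂ) (cj : Fin n),
          cj ∉ Used ∧ ψ cj ≠ 0 ∧ (∀ t, l t = s → ∑ y, ψ y * Nv t φ y = 0) ∧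
          (isB jf = false → ∀ m' : Fin n, (m' : ℕ) < j → isB m' = false → ψ (c m') = 0) ∧
          (isB jf = true → ∀ x, ψ x ≠ 0 → x = cj ∨ ∃ m' : Fin n, m' < jf ∧ isB m' = true ∧ x = c m') ∧
          (∀ t', des jf = some t' → Nv t' φ cj ≠ 0 ∨ ∀ x, x ∉ Used → x ≠ cj → Nv t' φ x = 0) := by
        -- the designation vector of this position (if any)
        let β' : Fin n → ℂ := match des jf with | some t' => Nv t' φ | none => 0
        have hβ' : ∀ t', des jf = some t' → β' = Nv t' φ := fun t' h => by simp [β', h]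
        have hcG := hcountG jf
        have hcB := hcountB jf
        rw [← hs] at hcG hcB
        have hjv : (jf : ℕ) = j := rfl
        rw [hjv] at hcG
        by_cases hcr : ∃ r : Fin n, r < jf ∧ ∃ t, des r = some t ∧ l t = s
        · -- CREDITED position
          obtain ⟨r₀, hr₀, t₀, ht₀, hlt₀⟩ := hcr
          obtain ⟨hf₀U, hprom⟩ := hcr_dec r₀ hr₀ t₀ ht₀ hlt₀
          have hB₀ : isB r₀ = true := (hdes r₀ t₀ ht₀).1
          have hCr1 : (univ.filter (fun r : Fin n => r < jf ∧ ∃ t, des r = some t ∧ l t = s)).card = 1 := by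
            refine le_antisymm (by have := hcred_le jf; rw [← hs] at this; exact this) (card_pos.mpr ⟨r₀, ?_⟩)
            simp only [mem_filter, mem_univ, true_and]; exact ⟨hr₀, t₀, ht₀, hlt₀⟩
          rw [hCr1] at hcG hcB
          have ht₀Ch : t₀ ∈ univ.filter (fun t => l t = s) := by simp [hlt₀]
          by_cases hb : isB jf = true
          · -- basis step with one credited constraint
            have hCh1 : ∀ t, l t = s → t = t₀ := by
              intro t ht
              have h1 := hcB hb
              exact card_le_one.mp h1 t (by simp [ht]) t₀ ht₀Ch
            obtain ⟨ψ, cj, hcjU, hψcj, hsupp, hk0, hdz⟩ :=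
              basis_row Used (by omega) true (Nv t₀ φ) (c r₀) (fun _ => hf₀U) (fun _ => hprom) β'
            refine ⟨ψ, cj, hcjU, hψcj, fun t ht => ?_, fun h => by rw [hb] at h; exact absurd h (by decide),
              fun _ x hx => ?_, fun t' ht' => ?_⟩
            · rw [hCh1 t ht]; exact hk0 rfl
            · rcases hsupp x hx with h | ⟨-, h⟩
              · exact Or.inl h
              · exact Or.inr ⟨r₀, hr₀, hB₀, h⟩
            · rw [← hβ' t' ht']; exact hdz
          · -- general step with one credited constraint
            have hb' : isB jf = false := by simpa using hb
            let B : Finset (Fin n → ℂ) := ((univ.filter (fun t => l t = s)).erase t₀).image (fun t => Nv t φ)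
            have hBcard : B.card + Used.card < n := by
              have h1 : B.card ≤ (univ.filter (fun t => l t = s)).card - 1 :=
                card_image_le.trans (by rw [card_erase_of_mem ht₀Ch])
              have h2 := hcG hb'
              have h3 : 1 ≤ (univ.filter (fun t => l t = s)).card := card_pos.mpr ⟨t₀, ht₀Ch⟩
              omega
            obtain ⟨ψ, cj, hcjU, hψcj, hvan, -, hkB, hk0⟩ :=
              general_row Used B true (Nv t₀ φ) (c r₀) hBcard (fun _ => hf₀U) (fun _ => hprom)
            refine ⟨ψ, cj, hcjU, hψcj, fun t ht => ?_, fun _ m' hm' hbm' => ?_,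
              fun h => absurd h hb, fun t' ht' => absurd (hdes jf t' ht').1 hb⟩
            · by_cases htt : t = t₀
              · rw [htt]; exact hk0 rfl
              · exact hkB _ (mem_image.mpr ⟨t, mem_erase.mpr ⟨htt, by simp [ht]⟩, rfl⟩)
            · refine hvan (c m') ((hUsed_mem _).mpr ⟨m', hm', rfl⟩) (fun h => ?_)
              have : m' = r₀ := hV4 m' r₀ hm' (by rw [Fin.lt_def] at hr₀; exact hr₀) h
              rw [this] at hbm'; rw [hbm'] at hB₀; exact Bool.false_ne_true hB₀
        · -- UNCREDITED position
          have hCr0 : (univ.filter (fun r : Fin n => r < jf ∧ ∃ t, des r = some t ∧ l t = s)).card = 0 := by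
            rw [Finset.card_eq_zero, filter_eq_empty_iff]
            intro r _ h; exact hcr ⟨r, h⟩
          rw [hCr0] at hcG hcB
          by_cases hb : isB jf = true
          · -- basis step, no constraint
            have hCh0 : ∀ t, l t ≠ s := by
              intro t ht
              have h1 := hcB hb
              rw [Nat.le_zero, Finset.card_eq_zero, filter_eq_empty_iff] at h1
              exact h1 (mem_univ t) ht
            obtain ⟨ψ, cj, hcjU, hψcj, hsupp, -, hdz⟩ :=
              basis_row Used (by omega) false 0 s (fun h => absurd h (by decide)) (fun h => absurd h (by decide)) β'
            refine ⟨ψ, cj, hcjU, hψcj, fun t ht => absurd ht (hCh0 t), fun h => by rw [hb] at h; exact absurd h (by decide),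
              fun _ x hx => ?_, fun t' ht' => ?_⟩
            · rcases hsupp x hx with h | ⟨h, -⟩
              · exact Or.inl h
              · exact absurd h (by decide)
            · rw [← hβ' t' ht']; exact hdz
          · -- general step, no credit
            have hb' : isB jf = false := by simpa using hb
            let B : Finset (Fin n → ℂ) := (univ.filter (fun t => l t = s)).image (fun t => Nv t φ)
            have hBcard : B.card + Used.card < n := by
              have h1 : B.card ≤ (univ.filter (fun t => l t = s)).card := card_image_le
              have h2 := hcG hb'
              omega
            obtain ⟨ψ, cj, hcjU, hψcj, -, hvan, hkB, -⟩ :=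
              general_row Used B false 0 s hBcard (fun h => absurd h (by decide)) (fun h => absurd h (by decide))
            refine ⟨ψ, cj, hcjU, hψcj, fun t ht => hkB _ (mem_image.mpr ⟨t, by simp [ht], rfl⟩),
              fun _ m' hm' _ => hvan rfl (c m') ((hUsed_mem _).mpr ⟨m', hm', rfl⟩),
              fun h => absurd h hb, fun t' ht' => absurd (hdes jf t' ht').1 hb⟩
      -- EXTENSION
      have hcjne : ∀ m : Fin n, (m : ℕ) < j → cj ≠ c m := fun m hm h => hcjU ((hUsed_mem _).mpr ⟨m, hm, h.symm⟩)
      refine ⟨Function.update φ s ψ, Function.update c jf cj, ?_, ?_, ?_, ?_, ?_⟩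
      · -- V1
        intro m hm hbm
        rcases Nat.lt_succ_iff_lt_or_eq.mp hm with hm' | hm'
        · have hmj : m ≠ jf := fun h => by rw [h] at hm'; exact lt_irrefl _ hm'
          obtain ⟨h1, h2⟩ := hV1 m hm' hbm
          refine ⟨by rw [Function.update_of_ne (hjs m hm'), Function.update_of_ne hmj]; exact h1, fun m' hmm hbm' => ?_⟩
          have hm'j : m' ≠ jf := fun h => by rw [h, Fin.lt_def] at hmm; exact absurd (lt_trans hmm hm') (lt_irrefl _)
          rw [Function.update_of_ne (hjs m hm'), Function.update_of_ne hm'j]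
          exact h2 m' hmm hbm'
        · have hmj : m = jf := Fin.ext hm'
          subst hmj
          refine ⟨by rw [← hs, Function.update_self, Function.update_self]; exact hψcj, fun m' hmm hbm' => ?_⟩
          have hm'j : m' ≠ jf := fun h => by rw [h] at hmm; exact lt_irrefl _ hmm
          rw [← hs, Function.update_self, Function.update_of_ne hm'j]
          exact hgenP hbm m' (by rw [Fin.lt_def] at hmm; exact hmm) hbm'
      · -- V2
        intro m hm hbm
        rcases Nat.lt_succ_iff_lt_or_eq.mp hm with hm' | hm'
        · have hmj : m ≠ jf := fun h => by rw [h] at hm'; exact lt_irrefl _ hm'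
          obtain ⟨h1, h2⟩ := hV2 m hm' hbm
          refine ⟨by rw [Function.update_of_ne (hjs m hm'), Function.update_of_ne hmj]; exact h1, fun x hx => ?_⟩
          rw [Function.update_of_ne (hjs m hm')] at hx
          rcases h2 x hx with h | ⟨m', hmm, hbm', h⟩
          · left; rw [Function.update_of_ne hmj]; exact h
          · right
            have hm'j : m' ≠ jf := fun e => by rw [e, Fin.lt_def] at hmm; exact absurd (lt_trans hmm hm') (lt_irrefl _)
            exact ⟨m', hmm, hbm', by rw [Function.update_of_ne hm'j]; exact h⟩
        · have hmj : m = jf := Fin.ext hm'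
          subst hmj
          refine ⟨by rw [← hs, Function.update_self, Function.update_self]; exact hψcj, fun x hx => ?_⟩
          rw [← hs, Function.update_self] at hx
          rcases hbasP hbm x hx with h | ⟨m', hmm, hbm', h⟩
          · left; rw [Function.update_self]; exact h
          · right
            have hm'j : m' ≠ jf := fun e => by rw [e] at hmm; exact lt_irrefl _ hmm
            exact ⟨m', hmm, hbm', by rw [Function.update_of_ne hm'j]; exact h⟩
      · -- V3
        intro t ht
        have hNv : Nv t (Function.update φ s ψ) = Nv t φ := by
          refine hloc t _ _ (fun s' hs' => Function.update_of_ne (fun h => ?_) _ _)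
          rw [h, hsj, Fin.lt_def] at hs'
          have : (ord.symm (l t) : ℕ) ≤ j := by omega
          exact absurd hs' (by simp [hjf]; omega)
        rw [hNv]
        rcases Nat.lt_succ_iff_lt_or_eq.mp ht with ht' | ht'
        · have hls : l t ≠ s := fun h => by rw [h, hsj] at ht'; exact lt_irrefl _ ht'
          rw [Function.update_of_ne hls]; exact hV3 t ht'
        · have hls : l t = s := by
            have e : ord.symm (l t) = jf := Fin.ext ht'
            calc l t = ord (ord.symm (l t)) := (Equiv.apply_symm_apply _ _).symm
              _ = s := by rw [e, hs]
          rw [hls, Function.update_self]; exact hkill t hls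
      · -- V4
        intro m m' hm hm' hcc
        rcases Nat.lt_succ_iff_lt_or_eq.mp hm with h1 | h1 <;> rcases Nat.lt_succ_iff_lt_or_eq.mp hm' with h2 | h2
        · have hmj : m ≠ jf := fun h => by rw [h] at h1; exact lt_irrefl _ h1
          have hmj' : m' ≠ jf := fun h => by rw [h] at h2; exact lt_irrefl _ h2
          rw [Function.update_of_ne hmj, Function.update_of_ne hmj'] at hcc
          exact hV4 m m' h1 h2 hcc
        · have hmj : m ≠ jf := fun h => by rw [h] at h1; exact lt_irrefl _ h1
          have hm'j : m' = jf := Fin.ext h2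
          rw [Function.update_of_ne hmj, hm'j, Function.update_self] at hcc
          exact absurd hcc.symm (hcjne m h1)
        · have hm'j : m' ≠ jf := fun h => by rw [h] at h2; exact lt_irrefl _ h2
          have hmj : m = jf := Fin.ext h1
          rw [Function.update_of_ne hm'j, hmj, Function.update_self] at hcc
          exact absurd hcc (hcjne m' h2)
        · exact Fin.ext (by rw [h1, h2])
      · -- V5
        intro r hr t ht hjt
        have hNv : Nv t (Function.update φ s ψ) = Nv t φ := by
          refine (hdes r t ht).2.2 _ _ (fun s' hs' => Function.update_of_ne (fun h => ?_) _ _)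
          rw [h, hsj, Fin.lt_def] at hs'
          exact absurd (lt_of_lt_of_le hs' (by simp [hjf]; omega)) (lt_irrefl _)
        rw [hNv]
        rcases Nat.lt_succ_iff_lt_or_eq.mp hr with hr' | hr'
        · have hrj : r ≠ jf := fun h => by rw [h] at hr'; exact lt_irrefl _ hr'
          rcases hV5 r hr' t ht (by omega) with h | h
          · left; rw [Function.update_of_ne hrj]; exact h
          · right; intro x hx
            refine h x (fun m hm => ?_)
            have hmj : m ≠ jf := fun e => by
              rw [e, Fin.le_def] at hm; exact absurd (lt_of_le_of_lt hm hr') (lt_irrefl _)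
            have := hx m hm
            rw [Function.update_of_ne hmj] at this; exact this
        · have hrj : r = jf := Fin.ext hr'
          subst hrj
          rcases hprom' t ht with h | h
          · left; rw [Function.update_self]; exact h
          · right; intro x hx
            refine h x (fun hxU => ?_) (by have := hx _ le_rfl; rw [Function.update_self] at this; exact this)
            obtain ⟨m, hm, hmx⟩ := (hUsed_mem x).mp hxU
            have hmj : m ≠ jf := fun e => by rw [e] at hm; exact lt_irrefl _ hm
            have := hx m (by rw [Fin.le_def]; exact le_of_lt hm)
            rw [Function.update_of_ne hmj] at this; exact this hmx.symm
  -- all positions processed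
  obtain ⟨φ, c, hV1, hV2, hV3, hV4, -⟩ := step n le_rfl
  have hcinj : Function.Injective c := fun m m' h => hV4 m m' m.isLt m'.isLt h
  let cperm : Equiv.Perm (Fin n) := Equiv.ofBijective c (Finite.injective_iff_bijective.mp hcinj)
  let F : Finset (Fin n) := univ.filter (fun i => isB (ord.symm i) = true)
  refine ⟨φ, fun t => hV3 t (ord.symm (l t)).isLt, ?_⟩
  rw [permanent_eq_prod_of_interleaved φ (ord.symm.trans cperm) (fun i => (ord.symm i : ℕ))
    (fun i i' h => ord.symm.injective (Fin.ext h)) F ?_ ?_]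
  · refine prod_ne_zero_iff.mpr fun i _ => ?_
    by_cases hi : isB (ord.symm i) = true
    · have := (hV2 (ord.symm i) (ord.symm i).isLt hi).1; simpa [cperm] using this
    · have := (hV1 (ord.symm i) (ord.symm i).isLt (by simpa using hi)).1; simpa [cperm] using this
  · intro f hf x hx
    have hfb : isB (ord.symm f) = true := by simpa [F] using hf
    have hx' : φ (ord (ord.symm f)) x ≠ 0 := by simpa using hx
    rcases (hV2 (ord.symm f) (ord.symm f).isLt hfb).2 x hx' with h | ⟨m', hmm, hbm', h⟩
    · left; simpa [cperm] using h
    · right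
      refine ⟨ord m', by simpa [F] using hbm', ?_, ?_⟩
      · have : ord.symm (ord m') = m' := Equiv.symm_apply_apply _ _
        rw [this]; rw [Fin.lt_def] at hmm; exact hmm
      · have : (ord.symm.trans cperm) (ord m') = c m' := by simp [cperm]
        rw [this]; exact h
  · intro i i' hi hi' hlt
    have hib : isB (ord.symm i) = false := by simpa [F] using hi
    have hib' : isB (ord.symm i') = false := by simpa [F] using hi'
    have := (hV1 (ord.symm i) (ord.symm i).isLt hib).2 (ord.symm i') (by rw [Fin.lt_def]; exact hlt) hib'
    simpa [cperm] using this

end LaplaceTriangular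

end Summit.ValiantsHypothesis.ValiantsHypothesis.Theorems.RigidityForcesSymmetryRankRigidMinimalRepr
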